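import Mathlib

/-!
# ζ(5) search — DENOM-LAW D1: the threshold model's finite SELECTION TABLE and level inequalities (theory-d1 g9; filed verbatim — plus six lint docstrings — by denom-prover-d1 g4)

Cell `pub-zeta5`, track DENOM-LAW (D1 theory).  HONEST FRAMING: systematic search; MODEL/structure side — elementary integer
inequalities about the level/class combinatorics of Brown–Zudilin cells and a finite table of integer 2×2 minors, i.e. the
kernel-checkable content of `denom-law/theory-d1g9/SELECTION-LAW-PROOF.md` (Theorem S (i) interior-level lemma and edge criteria,
(ii) rep-side constraint, (iv) the wedge table); nothing about ζ(5); no γ; no irrationality claim; records in print UNMOVED.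

Dictionary.  A class's root TYPE is `t = (L, R, np, nm)` = multiplicities of the roots `−m/2, +m/2, +3m/2, −3m/2` of its class
polynomial; at `m = 1` and in the doubled variable `z = 2ζ` the class polynomial is `Q_t(z) = (z+1)^L (z−1)^R (z−3)^np (z+3)^nm ∈ ℤ[z]`
and the Plücker wedge of two classes of equal degree `δ` is `σ·4^(δ−2)` with `σ = (P_t ∧ P_t')(1)`, where
`wedgeZ t t' = q₁ q₃' − q₃ q₁'` (`q_k` = coefficient of `z^k`).  Theorem S (iii) says two same-side classes of one cell have
ORDERED types (`RType.le`); the table below says ordered rep-side pairs of degree 3 or 4 have `wedgeZ ∈ {0, ±4^(δ−2)}`, i.e. `σ ∈ {0, ±1}`.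
-/

namespace Summit.KontsevichZagierPeriods.Zeta5Search.DenomLaw.ThresholdModel

/-- root type of a class: multiplicities of the roots `−m/2` (L), `+m/2` (R), `+3m/2` (np), `−3m/2` (nm). -/
structure RType where
  L : ℕ
  R : ℕ
  np : ℕ
  nm : ℕ
deriving DecidableEq, Repr

namespace RType

/-- total defect (degree of the class polynomial). -/
def delta (t : RType) : ℕ := t.L + t.R + t.np + t.nm

/-- rep-side constraints (Theorem S (ii)): on the side `u > 0`, `R ≤ L`, `nm ≤ np`, and the numerator extras are simple. -/
def repSide (t : RType) : Prop := t.R ≤ t.L ∧ t.nm ≤ t.np ∧ t.np ≤ 1 ∧ t.nm ≤ 1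

/-- `repSide` is decidable. -/
instance (t : RType) : Decidable t.repSide := by unfold repSide; infer_instance

/-- the order along increasing `u` (Theorem S (iii)): `L`, `np` non-decreasing, `R`, `nm` non-increasing. -/
def le (t t' : RType) : Prop := t.L ≤ t'.L ∧ t'.R ≤ t.R ∧ t.np ≤ t'.np ∧ t'.nm ≤ t.nm

/-- `le` is decidable. -/
instance (t t' : RType) : Decidable (t.le t') := by unfold le; infer_instance

end RType

/-- polynomial product on coefficient lists (low degree first). -/
def pmul : List ℤ → List ℤ → List ℤ
  | [], _ => []
  | a :: as, bs => padd (bs.map (a * ·)) (0 :: pmul as bs)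
where
  /-- coefficientwise sum keeping the longer tail -/
  padd : List ℤ → List ℤ → List ℤ
  | [], bs => bs
  | as, [] => as
  | a :: as, b :: bs => (a + b) :: padd as bs

/-- `(z - r)^k` times `P`. -/
def mulRootPow (P : List ℤ) (r : ℤ) : ℕ → List ℤ
  | 0 => P
  | k + 1 => pmul (mulRootPow P r k) [-r, 1]

/-- `Q_t(z) = (z+1)^L (z-1)^R (z-3)^np (z+3)^nm`, coefficients low → high. -/
def qpoly (t : RType) : List ℤ :=
  mulRootPow (mulRootPow (mulRootPow (mulRootPow [1] (-1) t.L) 1 t.R) 3 t.np) (-3) t.nm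

/-- integer Plücker wedge of the `(z¹, z³)` coefficients. -/
def wedgeZ (t t' : RType) : ℤ :=
  (qpoly t).getD 1 0 * (qpoly t').getD 3 0 - (qpoly t).getD 3 0 * (qpoly t').getD 1 0

/-- the rep-side types of degree 3: `(−1)³, (−1)²(+1), (−1)²(+3), (−1)(+1)(+3), (−3)(−1)(+3)`. -/
def repTypes3 : List RType := [⟨3,0,0,0⟩, ⟨2,1,0,0⟩, ⟨2,0,1,0⟩, ⟨1,1,1,0⟩, ⟨1,0,1,1⟩]

/-- the rep-side types of degree 4. -/
def repTypes4 : List RType :=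
  [⟨4,0,0,0⟩, ⟨3,1,0,0⟩, ⟨2,2,0,0⟩, ⟨3,0,1,0⟩, ⟨2,1,1,0⟩, ⟨2,0,1,1⟩, ⟨1,1,1,1⟩]

/-- completeness of the two lists (bounded enumeration, kernel-decided). -/
theorem mem_repTypes3_bdd : ∀ L ∈ List.range 5, ∀ R ∈ List.range 5, ∀ np ∈ List.range 2, ∀ nm ∈ List.range 2,
    R ≤ L → nm ≤ np → L + R + np + nm = 3 → (⟨L, R, np, nm⟩ : RType) ∈ repTypes3 := by decide

/-- completeness of `repTypes4` (bounded enumeration, kernel-decided). -/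
theorem mem_repTypes4_bdd : ∀ L ∈ List.range 5, ∀ R ∈ List.range 5, ∀ np ∈ List.range 2, ∀ nm ∈ List.range 2,
    R ≤ L → nm ≤ np → L + R + np + nm = 4 → (⟨L, R, np, nm⟩ : RType) ∈ repTypes4 := by decide

/-- every rep-side type of degree 3 is in `repTypes3`. -/
theorem mem_repTypes3 (t : RType) (h : t.repSide) (hd : t.delta = 3) : t ∈ repTypes3 := by
  obtain ⟨L, R, np, nm⟩ := t
  simp only [RType.repSide, RType.delta] at h hd
  obtain ⟨h1, h2, h3, h4⟩ := h
  exact mem_repTypes3_bdd L (List.mem_range.2 (by omega)) R (List.mem_range.2 (by omega)) np (List.mem_range.2 (by omega))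
    nm (List.mem_range.2 (by omega)) h1 h2 hd

/-- every rep-side type of degree 4 is in `repTypes4`. -/
theorem mem_repTypes4 (t : RType) (h : t.repSide) (hd : t.delta = 4) : t ∈ repTypes4 := by
  obtain ⟨L, R, np, nm⟩ := t
  simp only [RType.repSide, RType.delta] at h hd
  obtain ⟨h1, h2, h3, h4⟩ := h
  exact mem_repTypes4_bdd L (List.mem_range.2 (by omega)) R (List.mem_range.2 (by omega)) np (List.mem_range.2 (by omega))
    nm (List.mem_range.2 (by omega)) h1 h2 hd

/-- **THE SELECTION TABLE, δ = 3**: ordered rep-side pairs have `wedgeZ ∈ {±4}` (σ = ±1); checked by `decide`. -/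
theorem table3 : ∀ t ∈ repTypes3, ∀ t' ∈ repTypes3, t ≠ t' → (t.le t' ∨ t'.le t) →
    (wedgeZ t t' = 4 ∨ wedgeZ t t' = -4) := by decide

/-- **THE SELECTION TABLE, δ = 4**: ordered rep-side pairs have `wedgeZ ∈ {0, ±16}` (σ ∈ {0, ±1}); checked by `decide`. -/
theorem table4 : ∀ t ∈ repTypes4, ∀ t' ∈ repTypes4, (t.le t' ∨ t'.le t) →
    (wedgeZ t t' = 0 ∨ wedgeZ t t' = 16 ∨ wedgeZ t t' = -16) := by decide

/-- and the order is NEEDED: the unordered pairs realise the non-unit values (δ = 3: ±8, ±12; δ = 4: ±32, ±80). -/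
theorem table3_unordered_witness : wedgeZ ⟨3,0,0,0⟩ ⟨2,0,1,0⟩ = 8 ∧ wedgeZ ⟨3,0,0,0⟩ ⟨1,0,1,1⟩ = 12 := by decide

/-- δ = 4 unordered witnesses: `wedgeZ` takes the non-unit values 32, 80. -/
theorem table4_unordered_witness : wedgeZ ⟨4,0,0,0⟩ ⟨3,0,1,0⟩ = 32 ∧ wedgeZ ⟨4,0,0,0⟩ ⟨2,0,1,1⟩ = 80 := by decide

/-- **UNIT-PLÜCKER SELECTION LAW (type level).** Two rep-side types of equal degree `δ ∈ {3, 4}` that are ordered along `u`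
have integer wedge in `{0, ±4^(δ−2)}`. -/
theorem selection_law (t t' : RType) (ht : t.repSide) (ht' : t'.repSide) (hδ : t.delta = t'.delta)
    (h34 : t.delta = 3 ∨ t.delta = 4) (hord : t.le t' ∨ t'.le t) :
    wedgeZ t t' = 0 ∨ wedgeZ t t' = 4 ^ (t.delta - 2) ∨ wedgeZ t t' = -(4 ^ (t.delta - 2)) := by
  rcases h34 with h3 | h4
  · have m1 := mem_repTypes3 t ht h3
    have m2 := mem_repTypes3 t' ht' (hδ ▸ h3)
    rw [h3]
    by_cases hne : t = t'
    · subst hne; left; simp [wedgeZ, mul_comm]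
    · rcases table3 t m1 t' m2 hne hord with h | h <;> simp [h]
  · have m1 := mem_repTypes4 t ht h4
    have m2 := mem_repTypes4 t' ht' (hδ ▸ h4)
    rw [h4]
    rcases table4 t m1 t' m2 hord with h | h | h <;> simp [h]

/-! ## Level inequalities (Theorem S (i)): doubled positions.
Frame level `ℓ` of a class with doubled census offset `u ∈ (−p, p]` sits at doubled distance `p·(2ℓ − 3m + 2) − u` from the cell centre;
block `j` (doubled half-length `(m−1)p + ρ_j`, `ρ_j ≥ 0` = the box inequality) has a pole there iff `|p(2ℓ−3m+2) − u| ≤ (m−1)p + ρ_j`. -/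

/-- interior frame levels `m ≤ ℓ ≤ 2m−2` are ALWAYS pole levels of every block (this is exactly `ρ ≥ 0`). -/
theorem interior_level_is_pole (p m ρ u ℓ : ℤ) (hp : 0 < p) (hρ : 0 ≤ ρ) (hu1 : -p < u) (hu2 : u ≤ p)
    (h1 : m ≤ ℓ) (h2 : ℓ ≤ 2 * m - 2) :
    |p * (2 * ℓ - 3 * m + 2) - u| ≤ (m - 1) * p + ρ := by
  rw [abs_le]
  have a1 : p * (2 - m) ≤ p * (2 * ℓ - 3 * m + 2) := mul_le_mul_of_nonneg_left (by linarith) hp.le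
  have a2 : p * (2 * ℓ - 3 * m + 2) ≤ p * (m - 2) := mul_le_mul_of_nonneg_left (by linarith) hp.le
  constructor <;> nlinarith

/-- lower edge level `ℓ = m − 1` (doubled offset `−p·m`): a pole level iff `u ≤ ρ − p` (`= −a_j`); i.e. MISSING iff `u > −a_j`. -/
theorem lower_edge_pole_iff (p m ρ u : ℤ) (hp : 0 < p) (hm : 1 ≤ m) (_hρ : 0 ≤ ρ) (hu1 : -p < u) (_hu2 : u ≤ p) :
    |p * (2 * (m - 1) - 3 * m + 2) - u| ≤ (m - 1) * p + ρ ↔ u ≤ ρ - p := by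
  have e : p * (2 * (m - 1) - 3 * m + 2) - u = -(p * m + u) := by ring
  have pos : 0 < p * m + u := by nlinarith
  rw [e, abs_neg, abs_of_pos pos]
  constructor <;> intro h <;> nlinarith

/-- upper edge level `ℓ = 2m − 1` (doubled offset `+p·m`): a pole level iff `−u ≤ ρ − p`; i.e. MISSING iff `u < a_j = p − ρ`. -/
theorem upper_edge_pole_iff (p m ρ u : ℤ) (hp : 0 < p) (hm : 1 ≤ m) (_hρ : 0 ≤ ρ) (_hu1 : -p < u) (hu2 : u ≤ p) :
    |p * (2 * (2 * m - 1) - 3 * m + 2) - u| ≤ (m - 1) * p + ρ ↔ p - ρ ≤ u := by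
  have e : p * (2 * (2 * m - 1) - 3 * m + 2) - u = p * m - u := by ring
  have pos : 0 ≤ p * m - u := by nlinarith
  rw [e, abs_of_nonneg pos]
  constructor <;> intro h <;> nlinarith

/-- numerator (doubled half-length `b₀ = (3m−2)p + R₀`, `0 ≤ R₀ < 3p`): the extra level `ℓ = −1` (doubled offset `−3pm`) is a zero level
iff `u ≤ R₀ − 2p` (`= −A`). -/
theorem numerator_extra_low_iff (p m R₀ u : ℤ) (hp : 0 < p) (hm : 1 ≤ m) (_hR : 0 ≤ R₀) (hu1 : -p < u) (_hu2 : u ≤ p) :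
    |p * (2 * (-1) - 3 * m + 2) - u| ≤ (3 * m - 2) * p + R₀ ↔ u ≤ R₀ - 2 * p := by
  have e : p * (2 * (-1) - 3 * m + 2) - u = -(3 * p * m + u) := by ring
  have pos : 0 < 3 * p * m + u := by nlinarith
  rw [e, abs_neg, abs_of_pos pos]
  constructor <;> intro h <;> nlinarith

/-- … and the level `ℓ = −2` is NEVER a zero level when `R₀ < 3p` (so numerator extras have depth ≤ 1: roots `∓3m/2` only). -/
theorem numerator_no_second_extra (p m R₀ u : ℤ) (hp : 0 < p) (hm : 1 ≤ m) (hR : R₀ < 3 * p) (hu1 : -p < u) (_hu2 : u ≤ p) :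
    ¬ |p * (2 * (-2) - 3 * m + 2) - u| ≤ (3 * m - 2) * p + R₀ := by
  have e : p * (2 * (-2) - 3 * m + 2) - u = -(3 * p * m + 2 * p + u) := by ring
  have pos : 0 < 3 * p * m + 2 * p + u := by nlinarith
  rw [e, abs_neg, abs_of_pos pos]
  intro h; nlinarith

/-- numerator levels `0 ≤ ℓ ≤ 3m − 2` are always zero levels when `R₀ ≥ p` (no «numerator-short» class in the engine's boxes). -/
theorem numerator_frame_is_zero (p m R₀ u ℓ : ℤ) (hp : 0 < p) (hR : p ≤ R₀) (hu1 : -p < u) (hu2 : u ≤ p)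
    (h1 : 0 ≤ ℓ) (h2 : ℓ ≤ 3 * m - 2) :
    |p * (2 * ℓ - 3 * m + 2) - u| ≤ (3 * m - 2) * p + R₀ := by
  rw [abs_le]
  have a1 : p * (2 - 3 * m) ≤ p * (2 * ℓ - 3 * m + 2) := mul_le_mul_of_nonneg_left (by linarith) hp.le
  have a2 : p * (2 * ℓ - 3 * m + 2) ≤ p * (3 * m - 2) := mul_le_mul_of_nonneg_left (by linarith) hp.le
  constructor <;> nlinarith

/-! ## Rep-side constraint and monotonicity (Theorem S (ii), (iii)) as counting lemmas over the block index set. -/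

/-- `R(u) ≤ L(u)` for `u > 0`: every block counted in `R` (`u < a_j`) has `a_j > 0 > −u`, so it is counted in `L` (`−a_j < u`). -/
theorem R_le_L {ι : Type*} (S : Finset ι) (a : ι → ℤ) (u : ℤ) (hu : 0 < u) [DecidablePred fun j => u < a j]
    [DecidablePred fun j => -a j < u] :
    (S.filter fun j => u < a j).card ≤ (S.filter fun j => -a j < u).card := by
  apply Finset.card_le_card
  intro j hj
  simp only [Finset.mem_filter] at hj ⊢
  exact ⟨hj.1, by linarith [hj.2]⟩

/-- `L` is non-decreasing in `u`. -/
theorem L_mono {ι : Type*} (S : Finset ι) (a : ι → ℤ) (u u' : ℤ) (h : u ≤ u') [DecidablePred fun j => -a j < u]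
    [DecidablePred fun j => -a j < u'] :
    (S.filter fun j => -a j < u).card ≤ (S.filter fun j => -a j < u').card := by
  apply Finset.card_le_card
  intro j hj
  simp only [Finset.mem_filter] at hj ⊢
  exact ⟨hj.1, by linarith [hj.2]⟩

/-- `R` is non-increasing in `u`. -/
theorem R_anti {ι : Type*} (S : Finset ι) (a : ι → ℤ) (u u' : ℤ) (h : u ≤ u') [DecidablePred fun j => u < a j]
    [DecidablePred fun j => u' < a j] :
    (S.filter fun j => u' < a j).card ≤ (S.filter fun j => u < a j).card := by
  apply Finset.card_le_card
  intro j hj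
  simp only [Finset.mem_filter] at hj ⊢
  exact ⟨hj.1, by linarith [hj.2]⟩

/-- `nm ≤ np` on the rep side: `u ≤ −A` with `u > 0` forces `A < 0 ≤ u`, so `u ≥ A`. -/
theorem nm_le_np (A u : ℤ) (hu : 0 < u) (h : u ≤ -A) : A ≤ u := by linarith

end Summit.KontsevichZagierPeriods.Zeta5Search.DenomLaw.ThresholdModel
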